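import Summits.CriticalPhenomena.PercolationContinuityZ3.Theorems.Transplant.TriFilmSKBits
import Summits.CriticalPhenomena.PercolationContinuityZ3.Theorems.Transplant.Slab111SK4Geo
import Summits.CriticalPhenomena.PercolationContinuityZ3.Theorems.Transplant.TriFilmPaths
import HarnessLib

/-!
# Triangular film `𝕋 × {0,1}`, III: the base-12 bitboard INDICES AS VERTICES of `𝕋 × {0..k}`

builds on p205010 (kernel theorem, internal audit signed; external expert review pending) — NOT used in this file.  Lane `prim-bschramm`, seat
`prim-bschramm-p2` (gen 39; class C1b; memo `HOME/bschramm/P2-LATTICES.md` §138); helper file (`--supports stmt-CriticalPhenomena-4575 --as helper`).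
«Slab111SK4Geo» for the triangular films: an index `i = 144·L + 12·(a+6) + (b+6)` of a case context `C : CtxT` («TriFilmSKDefs») is the film vertex
`vtxT C.k z i = TriFilm.vx C.k (z + (a, b)) L` («TriFilmPaths»); validity covers `hexBall z 4` (both layers), the rerouting block has `triNorm ≤ 3`.
* §1 digits, validity (`validB_iff`), the column `relCol`, shadow and layer of `vtxT`, injectivity;
* §2 adjacency: `AdjRelT` of valid indices is a film edge (`adj_vtx`: planar `𝕋`-step inside a layer or vertical step inside a column, `TriFilm.adj_vx_iff`)
  and conversely (`adjRel_of_adj`); every film vertex over `hexBall z 4` has an index (`exists_idx`), so does every neighbour of a vertex over `hexBall z 3`;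
* §3 reading the block / window / centre / column tests (`inRB_iff_mem_blkR`, `inWinB_of_inWin`, `cenB_iff`, `testBit_colM_iff`, mask read-backs).
[cite: DuminilCopinSidoraviciusTassion2016, §2.3 (proof of Fact 2: the ball B_R(z))]
-/

noncomputable section

namespace Summit.CriticalPhenomena.PercolationContinuityZ3.Theorems.Transplant

open Literature.Probability.Percolation Literature.Probability.LatticeModels SimpleGraph
open scoped Classical

namespace TriFilm.SKT

open Slab111.SK (bitOf sdiff maskBelow maskOfList endsOK orFold testBit_bitOf testBit_sdiff testBit_maskBelow of_testBit_maskBelow testBit_maskBelow_of testBit_foldl_or)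
open Slab111.SK4 (dL4 dA4 dB4 colSlots4 digits_eq mod_digits testBit_colSlots)

/-! ## §1 Digits, validity, the vertex of an index -/

/-- Reading `validB`. [folklore] -/
theorem validB_iff (C : CtxT) (i : ℕ) : C.validB i = true ↔ i < 1440 ∧ 2 ≤ dA4 i ∧ dA4 i ≤ 10 ∧ 2 ≤ dB4 i ∧ dB4 i ≤ 10 ∧ 8 ≤ dA4 i + dB4 i ∧
    dA4 i + dB4 i ≤ 16 ∧ dL4 i ≤ C.k := by
  simp only [CtxT.validB, Bool.and_eq_true, decide_eq_true_eq, and_assoc]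

/-- The column of an index relative to the block centre `z`: `z + (a, b)`. [folklore] -/
def relCol (z : Site 2) (i : ℕ) : Site 2 := ![z 0 + ((dA4 i : ℤ) - 6), z 1 + ((dB4 i : ℤ) - 6)]

/-- **The film vertex of an index**: column `z + (a, b)`, layer `L`. [folklore] -/
def vtxT (k : ℕ) (z : Site 2) (i : ℕ) : triFilm k := vx k (relCol z i) (dL4 i)

variable {C : CtxT} {z : Site 2}

/-- The shadow of the vertex of an index. [folklore] -/
@[simp] theorem sh_vtx (k : ℕ) (z : Site 2) (i : ℕ) : (hexShadow k).sh (vtxT k z i) = relCol z i := rfl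

/-- Coordinates of the shadow. [folklore] -/
theorem sh_vtx_zero (k : ℕ) (z : Site 2) (i : ℕ) : (hexShadow k).sh (vtxT k z i) 0 = z 0 + ((dA4 i : ℤ) - 6) := rfl

/-- Coordinates of the shadow. [folklore] -/
theorem sh_vtx_one (k : ℕ) (z : Site 2) (i : ℕ) : (hexShadow k).sh (vtxT k z i) 1 = z 1 + ((dB4 i : ℤ) - 6) := rfl

/-- The layer of a valid index is at most `k`. [folklore] -/
theorem dL_le_of_valid {i : ℕ} (hv : C.validB i = true) : dL4 i ≤ C.k := ((validB_iff C i).1 hv).2.2.2.2.2.2.2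

/-- The layer of the vertex of a valid index. [folklore] -/
theorem lay_vtx {i : ℕ} (hv : C.validB i = true) : ((vtxT C.k z i : triFilm C.k) : Site 2 × Site 1).2 0 = dL4 i := vx_snd (dL_le_of_valid hv) _

/-- Two relative columns agree iff the column digits agree. [folklore] -/
theorem relCol_eq_iff (z : Site 2) (i j : ℕ) : relCol z i = relCol z j ↔ dA4 i = dA4 j ∧ dB4 i = dB4 j := by
  constructor
  · intro h
    have h0 := congrFun h 0; have h1 := congrFun h 1
    simp [relCol] at h0 h1; omega
  · rintro ⟨ha, hb⟩; simp [relCol, ha, hb]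

/-- **`vtxT` is injective on valid indices.** [folklore] -/
theorem vtx_inj {i j : ℕ} (hi : C.validB i = true) (hj : C.validB j = true) (h : vtxT C.k z i = vtxT C.k z j) : i = j := by
  have := (vx_inj (dL_le_of_valid hi) (dL_le_of_valid hj)).1 h
  rw [relCol_eq_iff] at this
  rw [digits_eq i, digits_eq j]; omega

/-! ## §2 Adjacency and indexing of film vertices -/

/-- `triNorm ≤ n` in linear form. [folklore] -/
theorem triNorm_le_iff_lin (v : Site 2) (n : ℤ) : triNorm v ≤ n ↔ -n ≤ v 0 ∧ v 0 ≤ n ∧ -n ≤ v 1 ∧ v 1 ≤ n ∧ -n ≤ v 0 + v 1 ∧ v 0 + v 1 ≤ n := by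
  simp only [triNorm, max_le_iff, abs_le]; tauto

/-- A non-zero vector has `triNorm ≥ 1`. [folklore] -/
theorem one_le_triNorm_of_ne (v : Site 2) (h : v 0 ≠ 0 ∨ v 1 ≠ 0) : 1 ≤ triNorm v := by
  rw [triNorm, le_max_iff, le_max_iff, le_abs, le_abs, le_abs]; omega

/-- One step in digits: a planar `𝕋`-step inside a layer, or a vertical step inside a column. [folklore] -/
def DigitStepT (i j : ℕ) : Prop :=
  (dL4 j = dL4 i ∧ ((dA4 j = dA4 i ∧ dB4 j = dB4 i + 1) ∨ (dA4 j = dA4 i + 1 ∧ dB4 j + 1 = dB4 i) ∨ (dA4 j = dA4 i + 1 ∧ dB4 j = dB4 i) ∨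
      (dA4 i = dA4 j ∧ dB4 i = dB4 j + 1) ∨ (dA4 i = dA4 j + 1 ∧ dB4 i + 1 = dB4 j) ∨ (dA4 i = dA4 j + 1 ∧ dB4 i = dB4 j))) ∨
    (dA4 j = dA4 i ∧ dB4 j = dB4 i ∧ (dL4 j = dL4 i + 1 ∨ dL4 i = dL4 j + 1))

/-- `AdjRelT` of indices with column digits in `[2, 10]` is a digit step. [folklore] -/
theorem digitStep_of_adjRel {i j : ℕ} (hi : 2 ≤ dA4 i ∧ dA4 i ≤ 10 ∧ 2 ≤ dB4 i ∧ dB4 i ≤ 10) (hj : 2 ≤ dA4 j ∧ dA4 j ≤ 10 ∧ 2 ≤ dB4 j ∧ dB4 j ≤ 10)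
    (h : AdjRelT i j) : DigitStepT i j := by
  have ei := digits_eq i; have ej := digits_eq j
  have mi := mod_digits i; have mj := mod_digits j
  unfold DigitStepT
  rcases h with h | h | h | h | h | h | h | h
  · exact Or.inl ⟨by omega, Or.inl ⟨by omega, by omega⟩⟩
  · exact Or.inl ⟨by omega, Or.inr (Or.inl ⟨by omega, by omega⟩)⟩
  · exact Or.inl ⟨by omega, Or.inr (Or.inr (Or.inl ⟨by omega, by omega⟩))⟩
  · exact Or.inr ⟨by omega, by omega, Or.inl (by omega)⟩
  · exact Or.inl ⟨by omega, Or.inr (Or.inr (Or.inr (Or.inl ⟨by omega, by omega⟩)))⟩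
  · exact Or.inl ⟨by omega, Or.inr (Or.inr (Or.inr (Or.inr (Or.inl ⟨by omega, by omega⟩))))⟩
  · exact Or.inl ⟨by omega, Or.inr (Or.inr (Or.inr (Or.inr (Or.inr ⟨by omega, by omega⟩))))⟩
  · exact Or.inr ⟨by omega, by omega, Or.inr (by omega)⟩

/-- A digit step is `AdjRelT`. [folklore] -/
theorem adjRel_of_digitStep {i j : ℕ} (h : DigitStepT i j) : AdjRelT i j := by
  have ei := digits_eq i; have ej := digits_eq j
  unfold AdjRelT
  rcases h with ⟨hl, ⟨h1, h2⟩ | ⟨h1, h2⟩ | ⟨h1, h2⟩ | ⟨h1, h2⟩ | ⟨h1, h2⟩ | ⟨h1, h2⟩⟩ | ⟨ha, hb, hl | hl⟩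
  · exact Or.inl (by omega)
  · exact Or.inr (Or.inl (by omega))
  · exact Or.inr (Or.inr (Or.inl (by omega)))
  · exact Or.inr (Or.inr (Or.inr (Or.inr (Or.inl (by omega)))))
  · exact Or.inr (Or.inr (Or.inr (Or.inr (Or.inr (Or.inl (by omega))))))
  · exact Or.inr (Or.inr (Or.inr (Or.inr (Or.inr (Or.inr (Or.inl (by omega)))))))
  · exact Or.inr (Or.inr (Or.inr (Or.inl (by omega))))
  · exact Or.inr (Or.inr (Or.inr (Or.inr (Or.inr (Or.inr (Or.inr (by omega)))))))

/-- Column digit ranges of a valid index. [folklore] -/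
theorem ranges_of_valid {C : CtxT} {i : ℕ} (hv : C.validB i = true) : 2 ≤ dA4 i ∧ dA4 i ≤ 10 ∧ 2 ≤ dB4 i ∧ dB4 i ≤ 10 := by
  have h := (validB_iff C i).1 hv
  exact ⟨h.2.1, h.2.2.1, h.2.2.2.1, h.2.2.2.2.1⟩

/-- A planar digit step is a `𝕋`-edge of the columns. [folklore] -/
theorem triGraph_adj_relCol {i j : ℕ}
    (h : (dA4 j = dA4 i ∧ dB4 j = dB4 i + 1) ∨ (dA4 j = dA4 i + 1 ∧ dB4 j + 1 = dB4 i) ∨ (dA4 j = dA4 i + 1 ∧ dB4 j = dB4 i) ∨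
      (dA4 i = dA4 j ∧ dB4 i = dB4 j + 1) ∨ (dA4 i = dA4 j + 1 ∧ dB4 i + 1 = dB4 j) ∨ (dA4 i = dA4 j + 1 ∧ dB4 i = dB4 j)) :
    triGraph.Adj (relCol z i) (relCol z j) := by
  rw [triGraph_adj_iff_triNorm]
  have e0 : (relCol z j - relCol z i) 0 = (dA4 j : ℤ) - dA4 i := by
    simp only [relCol, Pi.sub_apply, Matrix.cons_val_zero]; ring
  have e1 : (relCol z j - relCol z i) 1 = (dB4 j : ℤ) - dB4 i := by
    simp only [relCol, Pi.sub_apply, Matrix.cons_val_zero, Matrix.cons_val_one]; ring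
  refine le_antisymm ?_ (one_le_triNorm_of_ne _ ?_)
  · rw [triNorm_le_iff_lin, e0, e1]; omega
  · rw [e0, e1]; omega

/-- **Adjacent valid indices are adjacent film vertices.** [folklore] -/
theorem adj_vtx {i j : ℕ} (hi : C.validB i = true) (hj : C.validB j = true) (h : AdjRelT i j) :
    (film C.k).Adj (vtxT C.k z i) (vtxT C.k z j) := by
  rw [vtxT, vtxT, adj_vx_iff (dL_le_of_valid hi) (dL_le_of_valid hj)]
  rcases digitStep_of_adjRel (ranges_of_valid hi) (ranges_of_valid hj) h with ⟨hl, hp⟩ | ⟨ha, hb, hl⟩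
  · exact Or.inl ⟨triGraph_adj_relCol hp, hl.symm⟩
  · exact Or.inr ⟨(relCol_eq_iff z i j).2 ⟨ha.symm, hb.symm⟩, hl⟩

/-- **Adjacent vertices of valid indices have adjacent indices.** [folklore] -/
theorem adjRel_of_adj {i j : ℕ} (hi : C.validB i = true) (hj : C.validB j = true)
    (h : (film C.k).Adj (vtxT C.k z i) (vtxT C.k z j)) : AdjRelT i j := by
  rw [vtxT, vtxT, adj_vx_iff (dL_le_of_valid hi) (dL_le_of_valid hj)] at h
  apply adjRel_of_digitStep
  unfold DigitStepT
  rcases h with ⟨hadj, hl⟩ | ⟨hcol, hl⟩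
  · left
    refine ⟨hl.symm, ?_⟩
    rw [triGraph_adj_iff_triNorm] at hadj
    have e0 : (relCol z j - relCol z i) 0 = (dA4 j : ℤ) - dA4 i := by
      simp only [relCol, Pi.sub_apply, Matrix.cons_val_zero]; ring
    have e1 : (relCol z j - relCol z i) 1 = (dB4 j : ℤ) - dB4 i := by
      simp only [relCol, Pi.sub_apply, Matrix.cons_val_zero, Matrix.cons_val_one]; ring
    have hle := (triNorm_le_iff_lin _ 1).1 hadj.le
    have hne : (relCol z j - relCol z i) 0 ≠ 0 ∨ (relCol z j - relCol z i) 1 ≠ 0 := by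
      by_contra hc
      rw [not_or, not_not, not_not] at hc
      have : triNorm (relCol z j - relCol z i) ≤ 0 := by rw [triNorm_le_iff_lin]; omega
      omega
    rw [e0, e1] at hle hne
    omega
  · right
    rw [relCol_eq_iff] at hcol
    exact ⟨hcol.1.symm, hcol.2.symm, hl⟩

/-- **Every film vertex over `hexBall z 4` has a valid index** (`k ≤ 9`). [folklore] -/
theorem exists_idx (hk : C.k ≤ 9) (x : triFilm C.k) (hx : triNorm ((hexShadow C.k).sh x - z) ≤ 4) : ∃ i, C.validB i = true ∧ vtxT C.k z i = x := by
  obtain ⟨q, j, hj, rfl⟩ := exists_eq_vx x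
  rw [sh_vx, triNorm_le_iff_lin] at hx
  simp only [Pi.sub_apply] at hx
  obtain ⟨A, hA⟩ := Int.eq_ofNat_of_zero_le (show (0 : ℤ) ≤ q 0 - z 0 + 6 by omega)
  obtain ⟨B, hB⟩ := Int.eq_ofNat_of_zero_le (show (0 : ℤ) ≤ q 1 - z 1 + 6 by omega)
  have hdL : dL4 (144 * j + 12 * A + B) = j := by unfold dL4; omega
  have hdA : dA4 (144 * j + 12 * A + B) = A := by unfold dA4; omega
  have hdB : dB4 (144 * j + 12 * A + B) = B := by unfold dB4; omega
  refine ⟨144 * j + 12 * A + B, ?_, ?_⟩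
  · rw [validB_iff, hdL, hdA, hdB]; omega
  · rw [vtxT, hdL]
    congr 1
    ext t; fin_cases t
    · show z 0 + ((dA4 (144 * j + 12 * A + B) : ℤ) - 6) = q 0
      rw [hdA]; omega
    · show z 1 + ((dB4 (144 * j + 12 * A + B) : ℤ) - 6) = q 1
      rw [hdB]; omega

/-- **A neighbour of the vertex of a rerouting-block index has a valid index, adjacent in `AdjRelT`.** [folklore] -/
theorem exists_idx_of_adj (hk : C.k ≤ 9) {i : ℕ} (hi : C.validB i = true) (h3 : triNorm ((hexShadow C.k).sh (vtxT C.k z i) - z) ≤ 3)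
    {y : triFilm C.k} (h : (film C.k).Adj (vtxT C.k z i) y) : ∃ j, C.validB j = true ∧ vtxT C.k z j = y ∧ AdjRelT i j := by
  have hy : triNorm ((hexShadow C.k).sh y - z) ≤ 4 := by
    have h1' : triNorm ((hexShadow C.k).sh (vtxT C.k z i) - (hexShadow C.k).sh y) ≤ 1 := triNorm_sub_le_one h
    have h1 := (triNorm_le_iff_lin _ 1).1 h1'
    have h2 := (triNorm_le_iff_lin _ 3).1 h3
    simp only [Pi.sub_apply] at h1 h2
    rw [triNorm_le_iff_lin]
    simp only [Pi.sub_apply]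
    omega
  obtain ⟨j, hj, rfl⟩ := exists_idx hk y hy
  exact ⟨j, hj, rfl, adjRel_of_adj hi hj h⟩

/-! ## §3 Reading the block, window, centre and column tests -/

/-- The shadow of an index relative to the centre, in digits. [folklore] -/
theorem triNorm_vtx_le_iff (k : ℕ) (z : Site 2) (i : ℕ) (n : ℕ) :
    triNorm ((hexShadow k).sh (vtxT k z i) - z) ≤ n ↔
      dA4 i ≤ n + 6 ∧ 6 ≤ dA4 i + n ∧ dB4 i ≤ n + 6 ∧ 6 ≤ dB4 i + n ∧ dA4 i + dB4 i ≤ n + 12 ∧ 12 ≤ dA4 i + dB4 i + n := by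
  rw [sh_vtx, triNorm_le_iff_lin]
  simp only [relCol, Pi.sub_apply, Matrix.cons_val_zero, Matrix.cons_val_one]
  omega

/-- **The rerouting-block test reads membership in `blkR 3 z tR sR`.** [folklore] -/
theorem inRB_iff_mem_blkR {i : ℕ} (hv : C.validB i = true) {tR sR : ℕ} (htR : C.tR = min tR 3) (hsR : C.sR = min sR 3) :
    C.inRB i = true ↔ (hexShadow C.k).sh (vtxT C.k z i) ∈ blkR 3 z tR sR := by
  rw [mem_blkR, mem_hexBall, show ((3 : ℕ) : ℤ) = ((3 : ℕ) : ℤ) from rfl, triNorm_vtx_le_iff C.k z i 3, sh_vtx_zero, sh_vtx_one]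
  simp only [CtxT.inRB, hv, Bool.true_and, Bool.and_eq_true, decide_eq_true_eq, htR, hsR]
  omega

/-- Membership in the cleared block `blkR 3 z tD sD` from the digit test used for the allowed mask. [folklore] -/
theorem mem_blkR_of_digits (i : ℕ) {tD sD t1 s1 : ℕ} (ht : t1 ≤ tD) (hs : s1 ≤ sD)
    (h : 3 ≤ dA4 i ∧ dA4 i ≤ 9 ∧ 3 ≤ dB4 i ∧ dB4 i ≤ 9 ∧ 9 ≤ dA4 i + dB4 i ∧ dA4 i + dB4 i ≤ 15 ∧ dA4 i ≤ t1 + 6 ∧ dA4 i + dB4 i ≤ s1 + 12) :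
    (hexShadow C.k).sh (vtxT C.k z i) ∈ blkR 3 z tD sD := by
  rw [mem_blkR, mem_hexBall, show ((3 : ℕ) : ℤ) = ((3 : ℕ) : ℤ) from rfl, triNorm_vtx_le_iff C.k z i 3, sh_vtx_zero, sh_vtx_one]
  omega

/-- Reading membership in `hexBall z 1 ∩ blkR 3 z tD sD` into digits (for the forced mask). [folklore] -/
theorem digits_of_mem_hexBall_one (i : ℕ) {tD sD : ℕ} (h1 : (hexShadow C.k).sh (vtxT C.k z i) ∈ hexBall z 1)
    (hD : (hexShadow C.k).sh (vtxT C.k z i) ∈ blkR 3 z tD sD) :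
    5 ≤ dA4 i ∧ dA4 i ≤ 7 ∧ 5 ≤ dB4 i ∧ dB4 i ≤ 7 ∧ 11 ≤ dA4 i + dB4 i ∧ dA4 i + dB4 i ≤ 13 ∧ dA4 i ≤ tD + 6 ∧ dA4 i + dB4 i ≤ sD + 12 := by
  rw [mem_hexBall, show ((1 : ℕ) : ℤ) = ((1 : ℕ) : ℤ) from rfl, triNorm_vtx_le_iff C.k z i 1] at h1
  rw [mem_blkR, sh_vtx_zero, sh_vtx_one] at hD
  omega

/-- **The window test from the real window** (case bounds at least the node's, or unconstrained). [folklore] -/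
theorem inWinB_of_inWin {i : ℕ} (hv : C.validB i = true) {tD sR : ℕ} (hwT : tD ≤ C.wT ∨ 4 ≤ C.wT) (hwS : sR ≤ C.wS ∨ 4 ≤ C.wS)
    (h : HexShadow.InWin z tD sR ((hexShadow C.k).sh (vtxT C.k z i))) : C.inWinB i = true := by
  unfold HexShadow.InWin at h
  rw [sh_vtx_zero, sh_vtx_one] at h
  have hv' := (validB_iff C i).1 hv
  simp only [CtxT.inWinB, hv, Bool.true_and, Bool.and_eq_true, decide_eq_true_eq]
  omega

/-- **The centre test reads "over `z`".** [folklore] -/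
theorem cenB_iff {i : ℕ} (hv : C.validB i = true) : C.cenB i = true ↔ (hexShadow C.k).sh (vtxT C.k z i) = z := by
  simp only [CtxT.cenB, hv, Bool.true_and, Bool.and_eq_true, beq_iff_eq]
  rw [sh_vtx]
  constructor
  · rintro ⟨ha, hb⟩; ext t; fin_cases t <;> simp [relCol, ha, hb]
  · intro h
    have h0 := congrFun h 0; have h1 := congrFun h 1
    simp [relCol] at h0 h1; omega

/-- Two indices lie over the same column iff their column codes agree. [folklore] -/
theorem sh_eq_iff_mod (i j : ℕ) : (hexShadow C.k).sh (vtxT C.k z i) = (hexShadow C.k).sh (vtxT C.k z j) ↔ i % 144 = j % 144 := by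
  rw [sh_vtx, sh_vtx, relCol_eq_iff]
  have mi := mod_digits i; have mj := mod_digits j
  omega

/-- **Bits of a column mask**: the valid indices with the same column code. [folklore] -/
theorem testBit_colM_iff (C : CtxT) (e i : ℕ) : (C.colM e).testBit i = true ↔ C.validB i = true ∧ i % 144 = e % 144 := by
  unfold CtxT.colM
  rw [Nat.testBit_land, Bool.and_eq_true, Nat.testBit_shiftLeft, Bool.and_eq_true, decide_eq_true_eq, testBit_colSlots, CtxT.univ,
    testBit_maskBelow, Bool.and_eq_true, decide_eq_true_eq]
  constructor
  · rintro ⟨⟨hle, L, hL, hn⟩, hi, hv⟩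
    exact ⟨hv, by omega⟩
  · rintro ⟨hv, hmod⟩
    have hi := ((validB_iff C i).1 hv).1
    refine ⟨⟨by omega, i / 144, by omega, by omega⟩, hi, hv⟩

/-- Column mask membership reads equality of shadows. [folklore] -/
theorem testBit_colM_iff_sh {e i : ℕ} (hi : C.validB i = true) :
    (C.colM e).testBit i = true ↔ (hexShadow C.k).sh (vtxT C.k z i) = (hexShadow C.k).sh (vtxT C.k z e) := by
  rw [testBit_colM_iff, sh_eq_iff_mod]
  exact ⟨fun h => h.2, fun h => ⟨hi, h⟩⟩

/-- Universe bits are the valid indices. [folklore] -/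
theorem testBit_univ_iff (C : CtxT) (i : ℕ) : C.univ.testBit i = true ↔ C.validB i = true := by
  rw [CtxT.univ, testBit_maskBelow, Bool.and_eq_true, decide_eq_true_eq]
  exact ⟨fun h => h.2, fun h => ⟨((validB_iff C i).1 h).1, h⟩⟩

/-- `inRB` implies validity. [folklore] -/
theorem validB_of_inRB {C : CtxT} {i : ℕ} (h : C.inRB i = true) : C.validB i = true := by
  simp only [CtxT.inRB, Bool.and_eq_true] at h; exact h.1.1.1.1.1.1.1.1

/-- Rerouting-mask bits. [folklore] -/
theorem testBit_WR_iff (C : CtxT) (i : ℕ) : C.WR.testBit i = true ↔ C.W.testBit i = true ∧ C.inRB i = true := by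
  rw [CtxT.WR, Nat.testBit_land, Bool.and_eq_true, testBit_maskBelow, Bool.and_eq_true, decide_eq_true_eq]
  constructor
  · rintro ⟨hW, -, hR⟩; exact ⟨hW, hR⟩
  · rintro ⟨hW, hR⟩
    exact ⟨hW, ((validB_iff C i).1 (validB_of_inRB hR)).1, hR⟩

/-- Window-mask bits. [folklore] -/
theorem testBit_win_iff (C : CtxT) (i : ℕ) : C.win.testBit i = true ↔ C.inWinB i = true := by
  rw [CtxT.win, testBit_maskBelow, Bool.and_eq_true, decide_eq_true_eq]
  constructor
  · rintro ⟨-, h⟩; exact h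
  · intro h
    have hv : C.validB i = true := by simp only [CtxT.inWinB, Bool.and_eq_true] at h; exact h.1.1
    exact ⟨((validB_iff C i).1 hv).1, h⟩

/-- Centre-mask bits. [folklore] -/
theorem testBit_cen_iff (C : CtxT) (i : ℕ) : C.cen.testBit i = true ↔ C.cenB i = true := by
  rw [CtxT.cen, testBit_maskBelow, Bool.and_eq_true, decide_eq_true_eq]
  constructor
  · rintro ⟨-, h⟩; exact h
  · intro h
    have hv : C.validB i = true := by simp only [CtxT.cenB, Bool.and_eq_true] at h; exact h.1.1
    exact ⟨((validB_iff C i).1 hv).1, h⟩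

/-- `inRB` implies the radius-`3` digit bounds. [folklore] -/
theorem triNorm_le_three_of_inRB {i : ℕ} (h : C.inRB i = true) : triNorm ((hexShadow C.k).sh (vtxT C.k z i) - z) ≤ 3 := by
  rw [show (3 : ℤ) = ((3 : ℕ) : ℤ) from rfl, triNorm_vtx_le_iff C.k z i 3]
  simp only [CtxT.inRB, Bool.and_eq_true, decide_eq_true_eq] at h
  omega

end TriFilm.SKT

end Summit.CriticalPhenomena.PercolationContinuityZ3.Theorems.Transplant

end
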